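import Mathlib
import HarnessLib

/-!
# Sketch — stub-ideation k1 (gen 4) for `stub_cmLambdaLower` (S2 = RSL_g, stmt-BirchSwinnertonDyer-22608),
# line `bt26_lambda` of crux (R≥)ᵖ stmt-BirchSwinnertonDyer-26074.  TECHNIQUE «weaken / strengthen».

Seat `planner-sidea-stub_cmLambdaLower-1-g4-0`.  HONEST FRAMING: elementary lemmas only (cyclotomic products,
norms, rank–nullity, one arithmetic line); three SIGNATURES are `sorry`d and marked (A5, A6, C2).  Nothing here
touches a Selmer group, a reciprocity law or a main conjecture; 26074 and 22608 stay OPEN; BSD is not proved by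
any of this.

* §A (Plan 1, ORBIT / RESULTANT SOCKET — «strongest provable form of the N2 socket»).  The λ-inequality S2 consumes
  from the explicit reciprocity law is read off ORBIT PRODUCTS `∏_{ζ primitive of level n} F(ζ − 1)` (one number in
  `𝒪` per even level — Iwasawa's `e_n = μ·φ(pⁿ) + λ` currency, Lang CF I–II Ch. 5 §2 Cor. 2–3) instead of the value
  at ONE chosen primitive character per level (k1-g3 H6).  A1 `∏ (ζ − 1) = ±p` (exact, replaces k1-g3's sorried
  radius lemma H0), A2 the orbit-norm law `‖∏ F(ζ−1)‖ = ‖a_d‖^{φ(pⁿ)}·‖p‖^d`, A3/A3= the two-level criterion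
  (normalised orbit defect non-increasing ⇒ `d_G ≤ d_F`; constant ⇒ `=` and the μ-slope), A4 the Gauss block over an
  inversion-closed orbit (`‖∏ τ(χ)‖² = ‖N‖^{#orbit}` from the product formula A5 — no «τ(χ̄) is conjugate to τ(χ)»
  step, which is exactly what fails to be canonical in the critic's T6 case), A6 (signature) rationality of the
  θ-side orbit product (a resultant: lies in `K_g`).
* §B (Plan 2, ONE-SIDED FOUR-TERM — «weakest sufficient Poitou–Tate»).  B1: the kit's
  `CharIdealLambda.le_finrank_baseChange_of_fourTerm` (ALGEBRA-KIT-g15, "exactness ×4") needs, for the INEQUALITY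
  S2 consumes, only `ker g ≤ range f` (existence half of global duality at the plus quotient), `range g ≤ ker h`
  (composition zero) and `h` onto (automatic: `Sel₀ ⊆ Sel⁺`); injectivity of `𝐇¹/Z → Λ/(Col⁺ loc Z)` (DAG node N3)
  and `ker h ≤ range g` are NOT used.  Proved over a division ring after base change; B2 one-sided exactness descends
  along the flat base change; B3 the existence half passes from the finite stages (tree theorem
  `poitouTate_selmerStructure_duality_holds`) to the Iwasawa limit by Kőnig alone.
* §C (Plan 3, DECORATION-TOLERANT JOINT HOLD — «weakest sufficient print shape»).  C1: if both HOLD clauses are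
  stated for the SAME, possibly DECORATED, zeta element `z = D·z_γ` with the explicit slack `e = normλ(D)`, the
  combination S2 consumes is `D`-free (one `omega` line); C2 (signature): `λ(𝐇¹/Λ·Dz) = λ(𝐇¹/Λz) + λ(Λ/(D))`.
-/

set_option autoImplicit false
set_option linter.dupNamespace false
set_option maxHeartbeats 400000

noncomputable section

open scoped Classical TensorProduct
open Polynomial Finset

namespace Summit.BirchSwinnertonDyer.BirchSwinnertonDyer.Cruxes.ResidualThetaCountLowerPureAtTwo.StubIdeasK1G4

/-! ## §A  Plan 1 — the ORBIT / RESULTANT socket -/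

section OrbitSocket

/-- **A1 (PROVED). The orbit product of `1 − ζ` over the primitive `p^{k+1}`-th roots of unity is `p`**
(`= Φ_{p^{k+1}}(1)`; Mathlib `eval_one_cyclotomic_prime_pow` + `cyclotomic_eq_prod_X_sub_primitiveRoots`).
This exact identity replaces the radius computation `‖ζ − 1‖ = p^{-1/φ(p^{k+1})}` (k1-g3 H0, sorried) in every
ORBIT statement below.  [cite: LangCyclotomic1990, Ch. 5 §2, proof of Cor. 3 (`∏_{ζ^{pⁿ}=1, ζ≠1}(ζ−1) = pⁿ`)] -/
theorem prod_primitiveRoots_one_sub {K : Type*} [CommRing K] [IsDomain K] {p : ℕ} [Fact p.Prime] (k : ℕ)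
    {ζ : K} (hζ : IsPrimitiveRoot ζ (p ^ (k + 1))) :
    ∏ μ ∈ primitiveRoots (p ^ (k + 1)) K, (1 - μ) = (p : K) := by
  have h := eval_one_cyclotomic_prime_pow (R := K) (p := p) k
  rw [cyclotomic_eq_prod_X_sub_primitiveRoots hζ, eval_prod] at h
  simpa only [eval_sub, eval_X, eval_C] using h

/-- **A1′ (PROVED). Norm form:** `‖∏_{ζ primitive} (ζ − 1)‖ = ‖p‖` in any normed field containing the roots. -/
theorem norm_prod_primitiveRoots_sub_one {K : Type*} [NormedField K] {p : ℕ} [Fact p.Prime] (k : ℕ)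
    {ζ : K} (hζ : IsPrimitiveRoot ζ (p ^ (k + 1))) :
    ‖∏ μ ∈ primitiveRoots (p ^ (k + 1)) K, (μ - 1)‖ = ‖(p : K)‖ := by
  rw [← prod_primitiveRoots_one_sub k hζ, norm_prod, norm_prod]
  exact Finset.prod_congr rfl fun μ _ ↦ norm_sub_rev μ 1

/-- **A2 (PROVED). The ORBIT-NORM LAW.**  If on the level-`(k+1)` circle the values of `f` obey the dominant-term
law `‖f(ζ − 1)‖ = A·‖ζ − 1‖^d` (k1-g3 H5 `norm_tsum_eq_of_isNormLambdaIndex` gives exactly this for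
`f = F̂`, `A = ‖a_d‖`, `d = normλ(F)`, all large levels), then the orbit product has norm
`A^{φ(p^{k+1})} · ‖p‖^d` — Iwasawa's `e_n = μ·φ(pⁿ) + λ` for one level, the `λ`-part appearing WITHOUT any
radius because of A1.  [cite: LangCyclotomic1990, Ch. 5 §2 Cor. 2–3] [cite: Washington1997, §13.3 Thm. 13.13 (shape)] -/
theorem norm_orbitProd_eq {K : Type*} [NormedField K] {p : ℕ} [Fact p.Prime] (k : ℕ)
    {ζ : K} (hζ : IsPrimitiveRoot ζ (p ^ (k + 1))) (f : K → K) (A : ℝ) (d : ℕ)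
    (hf : ∀ μ ∈ primitiveRoots (p ^ (k + 1)) K, ‖f (μ - 1)‖ = A * ‖μ - 1‖ ^ d) :
    ‖∏ μ ∈ primitiveRoots (p ^ (k + 1)) K, f (μ - 1)‖ =
      A ^ Nat.totient (p ^ (k + 1)) * ‖(p : K)‖ ^ d := by
  rw [norm_prod, Finset.prod_congr rfl hf, Finset.prod_mul_distrib, Finset.prod_const,
    hζ.card_primitiveRoots, Finset.prod_pow, ← norm_prod, norm_prod_primitiveRoots_sub_one k hζ]

/-- **A2′ (PROVED). The same from an ANNULUS law** (the literal conclusion of k1-g3 H5: `∀ z, r < ‖z‖ < 1 →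
‖f z‖ = A·‖z‖^d`) at any level whose circle lies in the annulus. -/
theorem norm_orbitProd_eq_of_annulusLaw {K : Type*} [NormedField K] {p : ℕ} [Fact p.Prime] (k : ℕ)
    {ζ : K} (hζ : IsPrimitiveRoot ζ (p ^ (k + 1))) (f : K → K) (A r : ℝ) (d : ℕ)
    (hf : ∀ z : K, r < ‖z‖ → ‖z‖ < 1 → ‖f z‖ = A * ‖z‖ ^ d)
    (hlevel : ∀ μ ∈ primitiveRoots (p ^ (k + 1)) K, r < ‖μ - 1‖ ∧ ‖μ - 1‖ < 1) :
    ‖∏ μ ∈ primitiveRoots (p ^ (k + 1)) K, f (μ - 1)‖ =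
      A ^ Nat.totient (p ^ (k + 1)) * ‖(p : K)‖ ^ d :=
  norm_orbitProd_eq k hζ f A d fun μ hμ ↦ hf (μ - 1) (hlevel μ hμ).1 (hlevel μ hμ).2

/-- **A3 (PROVED). THE ORBIT SOCKET — two-level criterion, additive form.**  Write the orbit valuations at two
levels `n₁ < n₂` (beyond the root radii of both series) as `V_i = φ_i·m_F + d_F·c`, `W_i = φ_i·m_G + d_G·c`
(`φ_i = φ(p^{n_i})`, `c = v(p) > 0`, `m = ` the `μ`-type constant `v(a_d)`; this is A2 after `v = −log ‖·‖`).
If the NORMALISED ORBIT DEFECT `(V − W)/φ` does not increase from level `n₁` to level `n₂` (cross-multiplied: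
no division), then `d_G ≤ d_F`.  With `G = Lm` (`d_G = d`, the stub's binders) and `F = Col⁺_g(loc₂ z)` this is the
form in which S2 consumes the explicit reciprocity law: TWO LEVELS, ORBIT PRODUCTS, no choice of character, no
embedding of `ℚ(χ)`, no `χ ↔ χ̄` pairing, no `μ`. -/
theorem le_of_orbitDefect_antitone {dF dG : ℕ} {mF mG c φ₁ φ₂ V₁ V₂ W₁ W₂ : ℝ} (hc : 0 < c) (hφ : φ₁ < φ₂)
    (hV₁ : V₁ = φ₁ * mF + dF * c) (hV₂ : V₂ = φ₂ * mF + dF * c)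
    (hW₁ : W₁ = φ₁ * mG + dG * c) (hW₂ : W₂ = φ₂ * mG + dG * c)
    (h : φ₁ * (V₂ - W₂) ≤ φ₂ * (V₁ - W₁)) : dG ≤ dF := by
  have key : φ₂ * (V₁ - W₁) - φ₁ * (V₂ - W₂) = (φ₂ - φ₁) * (((dF : ℝ) - dG) * c) := by
    rw [hV₁, hV₂, hW₁, hW₂]; ring
  have h1 : 0 ≤ (φ₂ - φ₁) * (((dF : ℝ) - dG) * c) := by linarith
  have h2 : 0 ≤ ((dF : ℝ) - dG) * c := by
    by_contra hneg
    push Not at hneg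
    have : (φ₂ - φ₁) * (((dF : ℝ) - dG) * c) < 0 := mul_neg_of_pos_of_neg (by linarith) hneg
    linarith
  have h3 : (dG : ℝ) ≤ dF := by
    by_contra hlt
    push Not at hlt
    have : ((dF : ℝ) - dG) * c < 0 := mul_neg_of_neg_of_pos (by linarith) hc
    linarith
  exact_mod_cast h3

/-- **A3= (PROVED). Equality road for free:** if the normalised orbit defect is the SAME at the two levels then
`d_F = d_G` (apply A3 twice), and the common slope is `m_F − m_G = ((V₂−W₂) − (V₁−W₁))/(φ₂−φ₁)` — the
`μ`-transport datum `μ(Col⁺ loc z) − μ(Lm) = v(c_γ)` that the equality item RSCE/26076 wants, from the same data. -/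
theorem eq_of_orbitDefect_const {dF dG : ℕ} {mF mG c φ₁ φ₂ V₁ V₂ W₁ W₂ : ℝ} (hc : 0 < c) (hφ : φ₁ < φ₂)
    (hV₁ : V₁ = φ₁ * mF + dF * c) (hV₂ : V₂ = φ₂ * mF + dF * c)
    (hW₁ : W₁ = φ₁ * mG + dG * c) (hW₂ : W₂ = φ₂ * mG + dG * c)
    (h : φ₁ * (V₂ - W₂) = φ₂ * (V₁ - W₁)) : dF = dG ∧ (φ₂ - φ₁) * (mF - mG) = (V₂ - W₂) - (V₁ - W₁) := by
  refine ⟨le_antisymm ?_ ?_, ?_⟩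
  · exact le_of_orbitDefect_antitone (dF := dG) (dG := dF) hc hφ hW₁ hW₂ hV₁ hV₂ (by linarith)
  · exact le_of_orbitDefect_antitone hc hφ hV₁ hV₂ hW₁ hW₂ h.le
  · obtain ⟨hd, -⟩ : dF = dG ∧ True := ⟨le_antisymm
        (le_of_orbitDefect_antitone (dF := dG) (dG := dF) hc hφ hW₁ hW₂ hV₁ hV₂ (by linarith))
        (le_of_orbitDefect_antitone hc hφ hV₁ hV₂ hW₁ hW₂ h.le), trivial⟩
    subst hd
    rw [hV₁, hV₂, hW₁, hW₂]; ring

/-- **A4 (PROVED from the product formula). The GAUSS BLOCK over an inversion-closed orbit.**  For a finite set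
`O` of characters closed under `χ ↦ χ⁻¹`, if each `χ ∈ O` satisfies the product formula
`τ(χ)·τ(χ⁻¹) = χ(−1)·N` (A5), then `‖∏_{χ∈O} τ(χ)‖² = ‖N‖^{#O}`: reindex the second copy of the product by
inversion.  No fixed-point-freeness, no «τ(χ̄) is a Galois conjugate of τ(χ)» (k1-g3 H8's content, which is what
is not canonical when `K_{g,λ}` meets `ℚ₂(μ_{2^∞})` — the critic's T6 case). -/
theorem norm_prod_gaussSum_sq {R : Type*} [NormedField R] {N : ℕ} [NeZero N]
    (ψ : AddChar (ZMod N) R) (O : Finset (DirichletCharacter R N)) (hO : ∀ χ ∈ O, χ⁻¹ ∈ O)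
    (hGauss : ∀ χ ∈ O, gaussSum χ ψ * gaussSum χ⁻¹ ψ = χ (-1) * N) :
    ‖∏ χ ∈ O, gaussSum χ ψ‖ ^ 2 = ‖(N : R)‖ ^ O.card := by
  have hnorm1 : ∀ χ ∈ O, ‖(χ (-1) : R)‖ = 1 := by
    intro χ _
    have h2 : (χ (-1)) ^ 2 = 1 := by rw [← map_pow, neg_one_sq, map_one]
    have h3 : ‖χ (-1)‖ ^ 2 = 1 := by rw [← norm_pow, h2, norm_one]
    exact (pow_eq_one_iff_of_nonneg (norm_nonneg _) two_ne_zero).mp h3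
  have hre : ∏ χ ∈ O, ‖gaussSum χ ψ‖ = ∏ χ ∈ O, ‖gaussSum χ⁻¹ ψ‖ :=
    Finset.prod_nbij' (fun χ ↦ χ⁻¹) (fun χ ↦ χ⁻¹) (fun χ hχ ↦ hO χ hχ) (fun χ hχ ↦ hO χ hχ)
      (fun χ _ ↦ inv_inv χ) (fun χ _ ↦ inv_inv χ) (fun χ _ ↦ by rw [inv_inv])
  calc ‖∏ χ ∈ O, gaussSum χ ψ‖ ^ 2
      = (∏ χ ∈ O, ‖gaussSum χ ψ‖) * ∏ χ ∈ O, ‖gaussSum χ⁻¹ ψ‖ := by rw [sq, norm_prod, ← hre]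
    _ = ∏ χ ∈ O, ‖gaussSum χ ψ * gaussSum χ⁻¹ ψ‖ := by
          rw [← Finset.prod_mul_distrib]
          exact Finset.prod_congr rfl fun χ _ ↦ (norm_mul _ _).symm
    _ = ∏ χ ∈ O, ‖(N : R)‖ :=
          Finset.prod_congr rfl fun χ hχ ↦ by rw [hGauss χ hχ, norm_mul, hnorm1 χ hχ, one_mul]
    _ = ‖(N : R)‖ ^ O.card := Finset.prod_const _

/-- **A5 (signature). The product formula for a PRIMITIVE character of any modulus** `N`:
`τ(χ)·τ(χ⁻¹) = χ(−1)·N` (with the additive character `a ↦ ζ^a`, `ζ` a primitive `N`-th root of unity).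
Mathlib has the FIELD case `gaussSum_mul_gaussSum_eq_card` (`ZMod p`); the tree's TP2 files
(`…HondaLogCharSums`: `gaussSum_changeLevel_zmodChar`, vanishing for imprimitive) do the `2`-power level
bookkeeping; this is the classical (9.7) + Thm 9.7 of Montgomery–Vaughan.  Size S.
[cite: MontgomeryVaughan2007, §9.1 (9.7) and Thm. 9.7 (`τ(χ)‾ = χ(−1)τ(χ̄)`, `|τ(χ)|² = q` for primitive `χ`)] -/
theorem gaussSum_mul_gaussSum_inv_of_isPrimitive {R : Type*} [CommRing R] [IsDomain R] {N : ℕ} [NeZero N]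
    (χ : DirichletCharacter R N) (hχ : χ.IsPrimitive) {ζ : R} (hζ : IsPrimitiveRoot ζ N) :
    gaussSum χ (AddChar.zmodChar N hζ.pow_eq_one) * gaussSum χ⁻¹ (AddChar.zmodChar N hζ.pow_eq_one) =
      χ (-1) * N := by
  sorry

/-- **A6 (signature). Rationality of the θ-side orbit product.**  For a polynomial `P` with coefficients in a field
`F` (in the route: `P = mazurTateElementK g Ω 2 n ∈ K_g[X]`, `K_g = coeffField g`) the orbit product
`∏_{ζ primitive n-th} P(ζ − 1)` over ALL primitive roots in an extension `L` lies in `F` (it is the resultant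
`Res_X(Φ_n(1+X), P)` up to sign): so the θ-side of the orbit ledger is the `𝔭_ι`-adic valuation of an element of the
NUMBER FIELD `K_g`, and the `L`-values enter only through `N_{K_g(χ)/K_g}` of Shimura-algebraic numbers — no
`2`-adic embedding of `ℚ(χ)`, no character labels.  Size S/M (symmetric functions of the roots of `Φ_n ∈ F[X]`).
[cite: LangAlgebra2002, IV §8 (resultant = product over roots)] -/
theorem prod_primitiveRoots_aeval_mem_range (F L : Type*) [Field F] [Field L] [Algebra F L] (P : F[X])
    {n : ℕ} (hn : 0 < n) {ζ : L} (hζ : IsPrimitiveRoot ζ n) :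
    ∏ μ ∈ primitiveRoots n L, aeval (μ - 1) P ∈ (algebraMap F L).range := by
  sorry

end OrbitSocket

/-! ## §B  Plan 2 — ONE-SIDED four-term (weakest sufficient Poitou–Tate) -/

section OneSidedFourTerm

/-- **B1 (PROVED). The four-term λ-inequality needs only 2½ of the 4 exactness conditions.**  In the kit's
`le_finrank_baseChange_of_fourTerm` (ALGEBRA-KIT-g15 file 4; `H1Z → Q → X → X0`, "exactness ×4") the conclusion
`m ≤ λ(X)` (from `m ≤ λ(Q)` and the flank `λ(H1Z) ≤ λ(X0)`) already follows from
`ker g ≤ range f` (the EXISTENCE half of global duality at the plus quotient: a local functional killing the image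
of `Sel⁺` comes from a global Iwasawa class), `range g ≤ ker h` (composition zero) and `h` onto (`Sel₀ ⊆ Sel⁺`).
NOT needed: `f` injective (DAG node N3: `𝐇¹_+ = 0`, the rank-one kernel lemma) and `ker h ≤ range g` (easy
reciprocity).  Stated after base change to the fraction field (finite-dimensional spaces over a division ring);
the descent of the three hypotheses along the flat base change `K ⊗_𝒪 −` is the kit's bookkeeping (B2). -/
theorem le_finrank_of_fourTerm_oneSided {K : Type*} [DivisionRing K] {V₁ Q X X₀ : Type*}
    [AddCommGroup V₁] [Module K V₁] [AddCommGroup Q] [Module K Q] [AddCommGroup X] [Module K X]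
    [AddCommGroup X₀] [Module K X₀] [FiniteDimensional K V₁] [FiniteDimensional K Q]
    [FiniteDimensional K X] [FiniteDimensional K X₀]
    (f : V₁ →ₗ[K] Q) (g : Q →ₗ[K] X) (h : X →ₗ[K] X₀)
    (hQ : LinearMap.ker g ≤ LinearMap.range f) (hX : LinearMap.range g ≤ LinearMap.ker h)
    (hh : Function.Surjective h)
    {m : ℕ} (hm : m ≤ Module.finrank K Q) (hflank : Module.finrank K V₁ ≤ Module.finrank K X₀) :
    m ≤ Module.finrank K X := by
  have h1 := g.finrank_range_add_finrank_ker
  have h2 := h.finrank_range_add_finrank_ker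
  have h3 : Module.finrank K (LinearMap.ker g) ≤ Module.finrank K V₁ :=
    (Submodule.finrank_mono hQ).trans f.finrank_range_le
  have h4 : Module.finrank K (LinearMap.range g) ≤ Module.finrank K (LinearMap.ker h) :=
    Submodule.finrank_mono hX
  have h5 : Module.finrank K (LinearMap.range h) = Module.finrank K X₀ := by
    rw [LinearMap.range_eq_top.mpr hh, finrank_top]
  omega

/-- **B2 (PROVED). One-sided exactness descends along a flat base change.**  `ker g ≤ range f` for `A`-linear maps
gives the same for `K ⊗_A −` when `K` is `A`-flat (fraction field): `lTensor` preserves ranges (right exactness)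
and, by flatness, kernels. -/
theorem ker_lTensor_le_range_lTensor {A : Type*} [CommRing A] (K : Type*) [CommRing K] [Algebra A K]
    [Module.Flat A K] {V₁ Q X : Type*} [AddCommGroup V₁] [Module A V₁] [AddCommGroup Q] [Module A Q]
    [AddCommGroup X] [Module A X] (f : V₁ →ₗ[A] Q) (g : Q →ₗ[A] X)
    (hQ : LinearMap.ker g ≤ LinearMap.range f) :
    LinearMap.ker (g.lTensor K) ≤ LinearMap.range (f.lTensor K) := by
  -- factor `g` through `Q ⧸ range f`: `ker g ≤ range f` says `Q/range f → X` is injective on … ; we use the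
  -- exact pair (range f).subtype / (range f).mkQ and flatness.
  intro x hx
  -- `x ∈ ker (g ⊗ K)`; push to `Q/range f`: the induced map `ḡ : Q ⧸ range f → X` need not be injective, so we
  -- argue with the exact sequence `range f → Q → Q/ker g → 0` instead: `ker g ≤ range f` gives a surjection
  -- `Q / ker g ← Q / range f`… The clean route: `ker (g ⊗ K) = (ker g) ⊗ K` (flatness, as a range) `≤ (range f) ⊗ K`.
  have hker : LinearMap.ker (g.lTensor K) = LinearMap.range ((LinearMap.ker g).subtype.lTensor K) :=
    (Module.Flat.lTensor_exact K (LinearMap.exact_subtype_ker_map g)).linearMap_ker_eq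
  rw [hker] at hx
  obtain ⟨y, rfl⟩ := hx
  -- `y ∈ (ker g) ⊗ K`; map it through the inclusion `ker g ≤ range f` and a preimage under `f`.
  have : LinearMap.range ((LinearMap.ker g).subtype.lTensor K) ≤ LinearMap.range (f.lTensor K) := by
    rw [LinearMap.range_le_iff_comap, Submodule.eq_top_iff']
    intro t
    simp only [Submodule.mem_comap]
    induction t using TensorProduct.induction_on with
    | zero => simp
    | tmul k v =>
        obtain ⟨w, hw⟩ : (v : Q) ∈ LinearMap.range f := hQ v.2
        exact ⟨k ⊗ₜ w, by simp [hw]⟩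
    | add a b ha hb => rw [map_add]; exact Submodule.add_mem _ ha hb
  exact this ⟨y, rfl⟩

/-- **B3 (PROVED). The existence half passes to the Iwasawa limit by Kőnig alone.**  Along a tower of FINITE stages
(`H n` = `H¹(ℚ_Σ/ℚ_n, T/ϖ^{k(n)})`, `P n` = the local plus-quotient at the same stage, `loc n` the localisation,
`tH`, `tP` the corestriction/reduction transitions), if a compatible local family `y` has a global preimage AT EVERY
FINITE STAGE (this is the tree THEOREM `PoitouTateReduction.poitouTate_selmerStructure_duality_holds`, field
`SelmerComplement` = «annihilator ⊆ image», for `𝓕 = plus-Selmer ≤ 𝓖 = relaxed at 2`), then `y` has a compatible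
global preimage in the limit `𝐇¹ = lim H n`.  No `lim¹`, no Mittag-Leffler, no injectivity: nonempty finite fibres
and `nonempty_sections_of_finite_inverse_system`.  This is why the ONE-SIDED port of `stub_fourTermSigma` is
finite-level PT (in the tree) + this lemma + pairing compatibility, instead of «compact Poitou–Tate over `ℚ_∞`». -/
theorem exists_compatible_preimage {H P : ℕ → Type} [∀ n, Finite (H n)]
    (tH : ∀ n, H (n + 1) → H n) (tP : ∀ n, P (n + 1) → P n) (loc : ∀ n, H n → P n)
    (hcomm : ∀ n x, loc n (tH n x) = tP n (loc (n + 1) x))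
    (y : ∀ n, P n) (hy : ∀ n, tP n (y (n + 1)) = y n)
    (hfib : ∀ n, ∃ x : H n, loc n x = y n) :
    ∃ x : ∀ n, H n, (∀ n, tH n (x (n + 1)) = x n) ∧ ∀ n, loc n (x n) = y n := by
  classical
  let F : ℕ → Type := fun n ↦ {x : H n // loc n x = y n}
  let tF : ∀ n, F (n + 1) ⟶ F n := fun n ↦
    TypeCat.ofHom (fun x : F (n + 1) ↦ (⟨tH n x.1, by rw [hcomm, x.2, hy]⟩ : F n))
  let G : CategoryTheory.Functor ℕᵒᵖ Type := CategoryTheory.Functor.ofOpSequence (X := F) tF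
  haveI : ∀ j : ℕᵒᵖ, Finite (G.obj j) := fun j ↦ by
    change Finite (F j.unop)
    infer_instance
  haveI : ∀ j : ℕᵒᵖ, Nonempty (G.obj j) := fun j ↦ by
    change Nonempty (F j.unop)
    obtain ⟨x, hx⟩ := hfib j.unop
    exact ⟨⟨x, hx⟩⟩
  obtain ⟨s, hs⟩ := nonempty_sections_of_finite_inverse_system G
  refine ⟨fun n ↦ (s (Opposite.op n) : F n).1, fun n ↦ ?_, fun n ↦ (s (Opposite.op n) : F n).2⟩
  have hmap : G.map (CategoryTheory.homOfLE (Nat.le_add_right n 1)).op = tF n :=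
    CategoryTheory.Functor.ofOpSequence_map_homOfLE_succ tF n
  have := hs (CategoryTheory.homOfLE (Nat.le_add_right n 1)).op
  rw [hmap] at this
  exact congrArg Subtype.val this

end OneSidedFourTerm

/-! ## §C  Plan 3 — DECORATION-TOLERANT joint HOLD (weakest sufficient print shape) -/

section DecorationTolerant

/-- **C1 (PROVED, arithmetic). Decorations cancel in the combination S2 consumes.**  If the reciprocity clause is
stated for a DECORATED zeta element `z = D·z_γ` — `Col⁺_g(loc₂ z) = D·c·Lm`, so `λ(Col⁺ loc z) ≥ d + e` with
`e = normλ(D)` — and the Burungale–Tian clause for the SAME `z` with the explicit slack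
`λ(𝐇¹/Λz) ≤ λ(𝐇²) + e` (true: `λ(𝐇¹/Λ·Dz_γ) = λ(𝐇¹/Λz_γ) + e = λ(𝐇²) + e`, C2), then the quantity the
four-term bound feeds on, `λ(Col⁺ loc z) − λ(𝐇¹/Λz) + λ(𝐇²)`, is still `≥ d`: the decoration is harmless as long as
BOTH clauses name the same `z` and the slack is carried explicitly.  (Critic rev 4 (P-Z)/(P-tie)/T1 in one line.) -/
theorem decoration_cancels {lamCol lamQuot lamH2 d e : ℕ}
    (hi : d + e ≤ lamCol) (hii : lamQuot ≤ lamH2 + e) :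
    d + lamQuot ≤ lamCol + lamH2 := by
  omega

/-- **C2 (signature). The decoration shifts the zeta quotient by exactly `λ(Λ/(D))`.**  For a `Λ_𝒪`-module `H`
(`= 𝐇¹(T_g)`, torsion-free of rank one, Kato Thm 12.4 — only «`z` has no `Λ`-torsion» is used), `z ∈ H` with
trivial annihilator and `0 ≠ D ∈ Λ_𝒪`: `0 → Λz/ΛDz ≅ Λ/(D) → H/ΛDz → H/Λz → 0` is exact, so in λ-currency
(kit: `LambdaLowerBoundO.finrank_baseChange_add_eq_of_exact`, `CharIdealLambda.finite_baseChange_of_isTorsion`)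
`λ(H/ΛDz) = λ(H/Λz) + λ(Λ/(D))`, and `λ(Λ/(D)) = normλ(D)` (p625410-family
`…finrank_quotientTorsion_quotient_span_eq_of_normLambda_iwasawaAlgebraO`).  Size S. -/
theorem finrank_baseChange_quot_span_smul {A : Type*} [CommRing A] [IsDomain A] (K : Type*) [Field K]
    [Algebra A K] [IsFractionRing A K]
    {H : Type*} [AddCommGroup H] [Module (PowerSeries A) H] [Module A H]
    [IsScalarTower A (PowerSeries A) H] [Module.Finite (PowerSeries A) H]
    (z : H) (hz : ∀ a : PowerSeries A, a • z = 0 → a = 0) (D : PowerSeries A) (hD : D ≠ 0)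
    (htors : Module.IsTorsion (PowerSeries A) (H ⧸ Submodule.span (PowerSeries A) {z})) :
    Module.finrank K (K ⊗[A] (H ⧸ Submodule.span (PowerSeries A) {D • z})) =
      Module.finrank K (K ⊗[A] (H ⧸ Submodule.span (PowerSeries A) {z})) +
        Module.finrank K (K ⊗[A] (PowerSeries A ⧸ Ideal.span {D})) := by
  sorry

end DecorationTolerant

end Summit.BirchSwinnertonDyer.BirchSwinnertonDyer.Cruxes.ResidualThetaCountLowerPureAtTwo.StubIdeasK1G4

end
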